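import Summits.Ventures.PercRepro.Night4T7C7Q8M0Z
import Summits.Ventures.PercRepro.Night4T7C8Q8M0Z
import Summits.Ventures.PercRepro.Night4T7C9Q8M0Z
import Summits.Ventures.PercRepro.Night4T7C43Q8M0Z
import Summits.Ventures.PercRepro.GenQTenEightResidue
import Summits.Ventures.PercRepro.GenQTenEightGap

/-!
# PercRepro — the `(10, 8)` row: the type-`7` residue assembled (night-4, gen 19 — modulo the gap of GenQTenEightGap; the certified case modules to land)
`jq_t7_residue_eight_of_gap` assembles the certificates `jq_t7_nonneg_c{d}_q8_m0` over the coranks `7 … 82` of `HighLayersEightResidue` at type `7`, the gap coranks (`typeGapEight`) taken from `HighLayersEightResidual`.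
-/
namespace PercRepro.Night4

open Finset ThmH SixFour GenQ PerFlat Star NightThree ThmN

variable {α : Type} [DecidableEq α] {M : Matroid α} [M.Finite]

/-- **The type-`7` residue of `HighLayersEightResidue` modulo the gap**: the coranks `7 … 82` — a plain-row certificate where one exists (the tree theorems `jq_t7_nonneg_c{d}_q8_m0`), the residual hypothesis `hres` on the `72` gap cases of `typeGapEight`. -/
theorem jq_t7_residue_eight_of_gap (hres : HighLayersEightResidual) (hs : Simple M) (hline : ∀ L ∈ flatsQ M 2, L.card ≤ 3) (hplane : ∀ P ∈ flatsQ M 3, P.card ≤ 6) (hsolid : ∀ F ∈ flatsQ M 4, F.card ≤ 10) (hflat5 : ∀ F ∈ flatsQ M 5, F.card ≤ 21) (hflat6 : ∀ F ∈ flatsQ M 6, F.card ≤ 43) (hflat7 : ∀ F ∈ flatsQ M 7, F.card ≤ 87) {G : Finset α} (hc : Core M 10) (hGf : G ∈ flatsQ M 8) (hF : TwoHyp M G 8) (hG : G ⊆ gr M) (hrG : M.eRk (G : Set α) = ((8 : ℕ) : ℕ∞)) (hmG : mTr M G = 0) (hlo : 8 + 7 ≤ G.card) (hhi : G.card < 91)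 : 0 ≤ Jq M G 8 7 := by
  obtain ⟨d, hd⟩ : ∃ d, G.card = 8 + d := ⟨G.card - 8, by omega⟩
  have h1 : 7 ≤ d := by omega
  have h2 : d ≤ 82 := by omega
  interval_cases d
  · exact jq_t7_nonneg_c7_q8_m0 hs hline hplane hsolid hflat5 hflat6 hflat7 hG hrG hd hmG
  · exact jq_t7_nonneg_c8_q8_m0 hs hline hplane hsolid hflat5 hflat6 hflat7 hG hrG hd hmG
  · exact jq_t7_nonneg_c9_q8_m0 hs hline hplane hsolid hflat5 hflat6 hflat7 hG hrG hd hmG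
  · exact hres M G hc hGf hF hmG 7 10 (by decide) hd
  · exact hres M G hc hGf hF hmG 7 11 (by decide) hd
  · exact hres M G hc hGf hF hmG 7 12 (by decide) hd
  · exact hres M G hc hGf hF hmG 7 13 (by decide) hd
  · exact hres M G hc hGf hF hmG 7 14 (by decide) hd
  · exact hres M G hc hGf hF hmG 7 15 (by decide) hd
  · exact hres M G hc hGf hF hmG 7 16 (by decide) hd
  · exact hres M G hc hGf hF hmG 7 17 (by decide) hd
  · exact hres M G hc hGf hF hmG 7 18 (by decide) hd
  · exact hres M G hc hGf hF hmG 7 19 (by decide) hd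
  · exact hres M G hc hGf hF hmG 7 20 (by decide) hd
  · exact hres M G hc hGf hF hmG 7 21 (by decide) hd
  · exact hres M G hc hGf hF hmG 7 22 (by decide) hd
  · exact hres M G hc hGf hF hmG 7 23 (by decide) hd
  · exact hres M G hc hGf hF hmG 7 24 (by decide) hd
  · exact hres M G hc hGf hF hmG 7 25 (by decide) hd
  · exact hres M G hc hGf hF hmG 7 26 (by decide) hd
  · exact hres M G hc hGf hF hmG 7 27 (by decide) hd
  · exact hres M G hc hGf hF hmG 7 28 (by decide) hd
  · exact hres M G hc hGf hF hmG 7 29 (by decide) hd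
  · exact hres M G hc hGf hF hmG 7 30 (by decide) hd
  · exact hres M G hc hGf hF hmG 7 31 (by decide) hd
  · exact hres M G hc hGf hF hmG 7 32 (by decide) hd
  · exact hres M G hc hGf hF hmG 7 33 (by decide) hd
  · exact hres M G hc hGf hF hmG 7 34 (by decide) hd
  · exact hres M G hc hGf hF hmG 7 35 (by decide) hd
  · exact hres M G hc hGf hF hmG 7 36 (by decide) hd
  · exact hres M G hc hGf hF hmG 7 37 (by decide) hd
  · exact hres M G hc hGf hF hmG 7 38 (by decide) hd
  · exact hres M G hc hGf hF hmG 7 39 (by decide) hd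
  · exact hres M G hc hGf hF hmG 7 40 (by decide) hd
  · exact hres M G hc hGf hF hmG 7 41 (by decide) hd
  · exact hres M G hc hGf hF hmG 7 42 (by decide) hd
  · exact jq_t7_nonneg_c43_q8_m0 hs hline hplane hsolid hflat5 hflat6 hflat7 hG hrG hd hmG
  · exact hres M G hc hGf hF hmG 7 44 (by decide) hd
  · exact hres M G hc hGf hF hmG 7 45 (by decide) hd
  · exact hres M G hc hGf hF hmG 7 46 (by decide) hd
  · exact hres M G hc hGf hF hmG 7 47 (by decide) hd
  · exact hres M G hc hGf hF hmG 7 48 (by decide) hd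
  · exact hres M G hc hGf hF hmG 7 49 (by decide) hd
  · exact hres M G hc hGf hF hmG 7 50 (by decide) hd
  · exact hres M G hc hGf hF hmG 7 51 (by decide) hd
  · exact hres M G hc hGf hF hmG 7 52 (by decide) hd
  · exact hres M G hc hGf hF hmG 7 53 (by decide) hd
  · exact hres M G hc hGf hF hmG 7 54 (by decide) hd
  · exact hres M G hc hGf hF hmG 7 55 (by decide) hd
  · exact hres M G hc hGf hF hmG 7 56 (by decide) hd
  · exact hres M G hc hGf hF hmG 7 57 (by decide) hd
  · exact hres M G hc hGf hF hmG 7 58 (by decide) hd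
  · exact hres M G hc hGf hF hmG 7 59 (by decide) hd
  · exact hres M G hc hGf hF hmG 7 60 (by decide) hd
  · exact hres M G hc hGf hF hmG 7 61 (by decide) hd
  · exact hres M G hc hGf hF hmG 7 62 (by decide) hd
  · exact hres M G hc hGf hF hmG 7 63 (by decide) hd
  · exact hres M G hc hGf hF hmG 7 64 (by decide) hd
  · exact hres M G hc hGf hF hmG 7 65 (by decide) hd
  · exact hres M G hc hGf hF hmG 7 66 (by decide) hd
  · exact hres M G hc hGf hF hmG 7 67 (by decide) hd
  · exact hres M G hc hGf hF hmG 7 68 (by decide) hd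
  · exact hres M G hc hGf hF hmG 7 69 (by decide) hd
  · exact hres M G hc hGf hF hmG 7 70 (by decide) hd
  · exact hres M G hc hGf hF hmG 7 71 (by decide) hd
  · exact hres M G hc hGf hF hmG 7 72 (by decide) hd
  · exact hres M G hc hGf hF hmG 7 73 (by decide) hd
  · exact hres M G hc hGf hF hmG 7 74 (by decide) hd
  · exact hres M G hc hGf hF hmG 7 75 (by decide) hd
  · exact hres M G hc hGf hF hmG 7 76 (by decide) hd
  · exact hres M G hc hGf hF hmG 7 77 (by decide) hd
  · exact hres M G hc hGf hF hmG 7 78 (by decide) hd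
  · exact hres M G hc hGf hF hmG 7 79 (by decide) hd
  · exact hres M G hc hGf hF hmG 7 80 (by decide) hd
  · exact hres M G hc hGf hF hmG 7 81 (by decide) hd
  · exact hres M G hc hGf hF hmG 7 82 (by decide) hd

end PercRepro.Night4
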